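import Mathlib
import HarnessLib
import Summits.Parity.Statement
import Summits.Parity.GeneralizedHardyLittlewood.Theses.SiegelSpectrumSplit
import Summits.Parity.GeneralizedHardyLittlewood.Theses.GapLimitPointSplit
import Summits.Parity.GeneralizedHardyLittlewood.Theorems.UpperGivenBoundedSiegelGlue
import Summits.Parity.GeneralizedHardyLittlewood.Theorems.LowerGivenBoundedSiegelGlue
import Summits.Parity.GeneralizedHardyLittlewood.Theorems.SiegelSpectrumSplitAssembly
import Summits.Parity.GeneralizedHardyLittlewood.Theorems.ShiftedPrimeFactorNecessity
import Literature.NumberTheory.Sieve.PrimeGapLimitPoints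
import Literature.NumberTheory.Sieve.PrimeGapLimitPointsZero
import Literature.NumberTheory.Sieve.PrimeGapLimitPointsOfGHL

/-!
# GapLimitPointSplitNecessity — HAND file (theorem-only; D-0026) for the BORN route `route-Parity-GapLimitPointSplit`
(rev 0, commit b758201dd918; items ThreePoint = stmt-Parity-31666, GapLift = stmt-Parity-31667, Assembly = 31668; shared
Q 25148 / FixedUpper 26852 / FixedLower 26863). `ThreePoint`, `GapLift`, `BoundedSiegelZeroQuality`, `FixedUpper`, `FixedLower`
ARE the born decls of `Summits.Parity.GeneralizedHardyLittlewood.Theses.GapLimitPointSplit` (same namespace); the record's uniform leaves are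
referred to as `SiegelSpectrumSplit.UniformUpperGivenFixed / SiegelSpectrumSplit.UniformLowerGivenFixed`; the kernel's auxiliary `def`s (PointPropertyAt,
ErdosGapConjecture, EmptyWindowPoisson) are INLINED, the kernel's `special_zero_mem` is dropped in favour of the tree theorem
`zero_mem_primeGapLimitSet` (gate dedup.landed, census-1 g8) so that this file carries theorem-shaped content only; the kernel's `closes` is
`closes_kernel` here (the born file owns `closes`). Land as `Theorems/GapLimitPointSplitNecessity.lean --supports stmt-Parity-31666`
(critic row 67 P1). Original kernel memo follows.

# GapLimitPointSplit — decomp-parity lens-2 («special vs generic»), generation 7, RESIDUAL MODE (D-0179)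

NODE beneath the record route `route-Parity-SiegelSpectrumSplit` (rev 4), hung beneath its two UNIFORM
(moving-shift) residual leaves jointly — UU = `SiegelSpectrumSplit.UniformUpperGivenFixed` (stmt-Parity-26853) and
UL = `SiegelSpectrumSplit.UniformLowerGivenFixed` (stmt-Parity-26864) — with the record's other leaves Q (25148),
FU = `FixedUpper` (26852), FL = `FixedLower` (26863) as shared context.

AXIS (new in the cell): the set `𝓛 = primeGapLimitSet` of limit points of the normalized consecutive prime
gaps `(p_{n+1} − p_n)/log p_n` and its `k`-POINT PROPERTY `HasPointProperty 𝓛 k` («among any k ordered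
reals some difference lies in 𝓛»).  Lens-2 reading: the SPECIAL gap scales `β ∈ {0, ∞}` are exactly the
ones settled by extra structure (`0 ∈ 𝓛`: GPY/Maynard, tree theorem `zero_mem_primeGapLimitSet`; `∞`:
Westzynthius/Erdős–Rankin), the GENERIC scale `β ∈ (0, ∞)` has no individual handle («no other explicit
number is known to lie in 𝓛», Granville 2022) and is reached only CLASS-wise through the pigeonhole dial
`k` (Banks–Freiberg–Maynard 2016 `k = 9`, Pintz `k = 5`, Merikoski 2020 `k = 4`; `k = 2` ⟺ Erdős's
conjecture `[0,∞) ⊆ 𝓛`).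

PIECES (target T := UU ∧ UL, in the context Q, FU, FL):
* `ThreePoint` (NEW, credited; tag WEAKER; leaf ATTACKABLE): `HasPointProperty primeGapLimitSet 3`,
  the literal notch `k = 3` strictly between the record `k = 4` and Erdős `k = 2`.
  NECESSARY: kernel `threePoint_of_ghl` (tree theorem `Gallagher.Ici_subset_primeGapLimitSet_of_GHL`
  BY NAME, then `k = 2 ⟹ k = 3`), `threePoint_of_leaves`, `threePoint_of_parity`.
  PRINTED METHOD FLOOR (Merikoski 2020, Remark 2): `k` points ⟸ the Maynard-weighted PAIR upper bound
  (pairsout) with constant `A < k`; `A = 4` (Selberg, BFM), `A = 3.99` (Chen's sieve, Merikoski);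
  `A < 3` gives this piece; `A < 2` gives Erdős and is parity-blocked (Bombieri).  Threshold 3 > floor 2:
  NOT barrier-excluded.
* `GapLift` (NEW; DECLARED RESIDUAL, zero credit): `ThreePoint → (UU ∧ UL)` — the residual weakened by
  exactly the face hypothesis (T13 (iv)).
* shared record leaves Q, FU, FL (verbatim, by import).

`closes : Q → FU → FL → ThreePoint → GapLift → GeneralizedHardyLittlewood` (5 binders, all consumed,
through the record's CLOSED glue theorems and `assembly_proof`); `node_iff : (UU ∧ UL) ↔ (ThreePoint ∧
GapLift)` given Q, FU, FL (exact modulo the sibling leaves, as for every notch node of the cell).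
0 sorry.
-/

namespace Summit.Parity.GeneralizedHardyLittlewood.Theses.GapLimitPointSplit

open Set Literature.NumberTheory.Sieve

/-! ## §1 The dial and the pieces -/









/-! ## §2 Elementary structure of the dial (vacuity guards, special side) -/

/-- The `2`-point property of a set `B` is exactly `[0, ∞) ⊆ B`. -/
theorem hasPointProperty_two_iff (B : Set ℝ) : HasPointProperty B 2 ↔ Set.Ici (0 : ℝ) ⊆ B := by
  constructor
  · intro h x hx
    obtain ⟨i, j, hij, hmem⟩ := h ![0, x] (by
      refine Fin.monotone_iff_le_succ.2 fun i => ?_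
      fin_cases i; simpa using hx)
    fin_cases i <;> fin_cases j <;> simp_all
  · intro h β hβ
    refine ⟨0, 1, by decide, h ?_⟩
    simpa using hβ (show (0 : Fin 2) ≤ 1 by decide)

/-- `[0, ∞) ⊆ B` gives the `k`-point property for every `k ≥ 2`. -/
theorem hasPointProperty_of_Ici_subset {B : Set ℝ} (h : Set.Ici (0 : ℝ) ⊆ B) {k : ℕ} (hk : 2 ≤ k) :
    HasPointProperty B k :=
  ((hasPointProperty_two_iff B).2 h).mono hk

/-- Vacuity guard: the `1`-point property is FALSE for every set (no pair `i < j` in `Fin 1`). -/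
theorem not_hasPointProperty_one (B : Set ℝ) : ¬ HasPointProperty B 1 := by
  intro h
  obtain ⟨i, j, hij, -⟩ := h (fun _ => 0) (fun _ _ _ => le_rfl)
  exact absurd hij (by omega)

/-- Vacuity guard: the `0`-point property is FALSE for every set. -/
theorem not_hasPointProperty_zero (B : Set ℝ) : ¬ HasPointProperty B 0 := by
  intro h
  obtain ⟨i, -, -, -⟩ := h (fun _ => 0) (fun _ _ _ => le_rfl)
  exact i.elim0

/-- The dial is monotone: `HasPointProperty primeGapLimitSet k → HasPointProperty primeGapLimitSet l` for `k ≤ l`. -/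
theorem pointPropertyAt_mono {k l : ℕ} (hkl : k ≤ l) (h : HasPointProperty primeGapLimitSet k) : HasPointProperty primeGapLimitSet l :=
  HasPointProperty.mono h hkl

/-- Bottom of the dial: `HasPointProperty primeGapLimitSet 2 ↔ (Set.Ici (0 : ℝ) ⊆ primeGapLimitSet)`. -/
theorem pointPropertyAt_two_iff_erdos : HasPointProperty primeGapLimitSet 2 ↔ (Set.Ici (0 : ℝ) ⊆ primeGapLimitSet) :=
  hasPointProperty_two_iff _

/-- `ThreePoint` is the dial at the literal `3`. -/
theorem threePoint_iff : ThreePoint ↔ HasPointProperty primeGapLimitSet 3 := Iff.rfl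

/-- The dial is not vacuous at any level: `HasPointProperty primeGapLimitSet k` fails for `k ≤ 1`. -/
theorem not_pointPropertyAt_of_le_one {k : ℕ} (hk : k ≤ 1) : ¬ HasPointProperty primeGapLimitSet k := by
  interval_cases k
  · exact not_hasPointProperty_zero _
  · exact not_hasPointProperty_one _

/- **SPECIAL side (settled): the special scale `0` is a limit point** — GPY/Maynard, tree theorem
`Literature.NumberTheory.Sieve.zero_mem_primeGapLimitSet` (unconditional in the kernel; cited by name, not restated —
gate dedup.landed). -/

/-- The special scale alone does NOT give the three-point property: `{0}` (indeed any set missing both `T`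
and `2T` for some `T > 0`) fails it — the generic class carries the content. -/
theorem not_hasPointProperty_three_singleton_zero : ¬ HasPointProperty ({0} : Set ℝ) 3 := by
  intro h
  obtain ⟨i, j, hij, hmem⟩ := h ![0, 1, 2] (by
    refine Fin.monotone_iff_le_succ.2 fun i => ?_
    fin_cases i <;> simp)
  fin_cases i <;> fin_cases j <;> simp at hij <;> norm_num at hmem

/-- **What `k = 3` says concretely:** for every `T ≥ 0`, `T ∈ 𝓛 ∨ 2T ∈ 𝓛` (points `0, T, 2T`). -/
theorem mem_or_two_mul_mem_of_threePoint (h : ThreePoint) {T : ℝ} (hT : 0 ≤ T) :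
    T ∈ primeGapLimitSet ∨ 2 * T ∈ primeGapLimitSet := by
  obtain ⟨i, j, hij, hmem⟩ := h ![0, T, 2 * T] (by
    refine Fin.monotone_iff_le_succ.2 fun i => ?_
    fin_cases i <;> simp <;> linarith)
  fin_cases i <;> fin_cases j <;> simp at hij <;> simp at hmem <;> (try ring_nf at hmem) <;>
    (try ring_nf) <;> tauto

/-- In particular `ThreePoint ⟹ 1 ∈ 𝓛 ∨ 2 ∈ 𝓛` — an explicit pair containing a limit point (OPEN; the record
`k = 4` gives only `1 ∈ 𝓛 ∨ 2 ∈ 𝓛 ∨ 3 ∈ 𝓛`, next theorem). -/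
theorem one_mem_or_two_mem_of_threePoint (h : ThreePoint) :
    (1 : ℝ) ∈ primeGapLimitSet ∨ (2 : ℝ) ∈ primeGapLimitSet := by
  simpa using mem_or_two_mul_mem_of_threePoint h zero_le_one

/-- **What the record `k = 4` says concretely:** `T ∈ 𝓛 ∨ 2T ∈ 𝓛 ∨ 3T ∈ 𝓛` for every `T ≥ 0`. -/
theorem mem_or_of_pointPropertyAt_four (h : HasPointProperty primeGapLimitSet 4) {T : ℝ} (hT : 0 ≤ T) :
    T ∈ primeGapLimitSet ∨ 2 * T ∈ primeGapLimitSet ∨ 3 * T ∈ primeGapLimitSet := by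
  obtain ⟨i, j, hij, hmem⟩ := h ![0, T, 2 * T, 3 * T] (by
    refine Fin.monotone_iff_le_succ.2 fun i => ?_
    fin_cases i <;> simp <;> linarith)
  fin_cases i <;> fin_cases j <;> simp at hij <;> simp at hmem <;> (try ring_nf at hmem) <;>
    (try ring_nf) <;> tauto

/-! ## §3 The record rung (k = 4) by name -/

/-- RECORD rung of the dial: Merikoski 2020 Theorem 1 (tree NAMED FACT `Merikoski2020_theorem1`) is the
`4`-point property. -/
theorem pointPropertyAt_four_of_merikoski (h : Merikoski2020_theorem1) : HasPointProperty primeGapLimitSet 4 :=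
  h.hasPointProperty_four

/-- Conversely the `4`-point property is the printed theorem (the two renderings agree). -/
theorem merikoski_of_pointPropertyAt_four (h : HasPointProperty primeGapLimitSet 4) : Merikoski2020_theorem1 :=
  merikoski2020_theorem1_of_hasPointProperty_four h

/-- The notch implies the record rung (dial monotonicity `3 ≤ 4`). -/
theorem pointPropertyAt_four_of_threePoint (h : ThreePoint) : HasPointProperty primeGapLimitSet 4 :=
  pointPropertyAt_mono (by norm_num) h

/-! ## §4 Necessity (every piece is implied by the conjunct, by the root, by the record leaves) -/

/-- **GHL ⟹ Erdős** — tree theorem `Gallagher.Ici_subset_primeGapLimitSet_of_GHL` BY NAME (Green–Tao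
Conj. 1.2 for shift systems `d = 1`, shifts `≤ λ·log N` ⟹ Gallagher moments ⟹ Poisson gaps ⟹ `[0,∞) ⊆ 𝓛`). -/
theorem erdos_of_ghl (h : _root_.GeneralizedHardyLittlewood) : (Set.Ici (0 : ℝ) ⊆ primeGapLimitSet) :=
  Gallagher.Ici_subset_primeGapLimitSet_of_GHL h

/-- **GHL ⟹ every rung of the dial** (`k ≥ 2`). -/
theorem pointPropertyAt_of_ghl (h : _root_.GeneralizedHardyLittlewood) {k : ℕ} (hk : 2 ≤ k) :
    HasPointProperty primeGapLimitSet k :=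
  hasPointProperty_of_Ici_subset (erdos_of_ghl h) hk

/-- **Necessity of the credited piece from the conjunct:** `GHL ⟹ ThreePoint`. -/
theorem threePoint_of_ghl (h : _root_.GeneralizedHardyLittlewood) : ThreePoint :=
  pointPropertyAt_of_ghl h (by norm_num)

/-- **Necessity from the root** `Parity := BatemanHorn ∧ GeneralizedHardyLittlewood`. -/
theorem threePoint_of_parity (h : Parity) : ThreePoint := threePoint_of_ghl h.2

/-- The residual is implied by the leaves it weakens. -/
theorem gapLift_of_uniform (hUU : SiegelSpectrumSplit.UniformUpperGivenFixed) (hUL : SiegelSpectrumSplit.UniformLowerGivenFixed) : GapLift :=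
  fun _ => ⟨hUU, hUL⟩

/-- **Necessity of the residual from the conjunct** (tree theorems
`ShiftedPrimeFactor.uniformUpperGivenFixed_of_ghl` / `uniformLowerGivenFixed_of_ghl` BY NAME). -/
theorem gapLift_of_ghl (h : _root_.GeneralizedHardyLittlewood) : GapLift :=
  gapLift_of_uniform (ShiftedPrimeFactor.uniformUpperGivenFixed_of_ghl h)
    (ShiftedPrimeFactor.uniformLowerGivenFixed_of_ghl h)

/-- Necessity of the residual from the root. -/
theorem gapLift_of_parity (h : Parity) : GapLift := gapLift_of_ghl h.2

/-- The record leaves jointly give the conjunct (record `assembly_proof` + CLOSED glue theorems, BY NAME). -/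
theorem ghl_of_leaves (hQ : BoundedSiegelZeroQuality) (hFU : FixedUpper) (hUU : SiegelSpectrumSplit.UniformUpperGivenFixed)
    (hFL : FixedLower) (hUL : SiegelSpectrumSplit.UniformLowerGivenFixed) : _root_.GeneralizedHardyLittlewood :=
  SiegelSpectrumSplit.assembly_proof hQ (SiegelSpectrumSplit.upperGivenBoundedSiegelGlue_holds hFU hUU)
    (SiegelSpectrumSplit.lowerGivenBoundedSiegelGlue_holds hFL hUL)

/-- **T13 (i): the credited piece lies on a face of the residual leaves' own conclusion** — given the
sibling leaves Q, FU, FL, the two uniform leaves UU ∧ UL deliver GHL, whose `d = 1`, shifts-`≤ λ log N`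
face is Gallagher's input; hence `ThreePoint`. -/
theorem threePoint_of_leaves (hQ : BoundedSiegelZeroQuality) (hFU : FixedUpper)
    (hUU : SiegelSpectrumSplit.UniformUpperGivenFixed) (hFL : FixedLower) (hUL : SiegelSpectrumSplit.UniformLowerGivenFixed) : ThreePoint :=
  threePoint_of_ghl (ghl_of_leaves hQ hFU hUU hFL hUL)

/-! ## §4b The rungs between the face and the notch (all by name): GHL ⟹ Poisson(k = 0) ⟹ Erdős ⟹ k = 3 -/

open Filter Topology in


/-- GHL ⟹ the empty-window Poisson law (tree theorem `Gallagher.poisson_of_GHL`, case `k = 0`, BY NAME). -/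
theorem emptyWindowPoisson_of_ghl (h : _root_.GeneralizedHardyLittlewood) :
    (∀ s : ℝ, 0 < s → ∀ g : ℕ → ℕ,
    Filter.Tendsto (fun N : ℕ => (g N : ℝ) / Real.log N) Filter.atTop (nhds s) →
    Filter.Tendsto (fun N : ℕ => (Gallagher.exactCount 0 (g N) N : ℝ) / N) Filter.atTop (nhds (Real.exp (-s)))) :=
  fun s hs g hg => by simpa using Gallagher.poisson_of_GHL h hs hg 0

/-- Poisson(k = 0) ⟹ Erdős (tree theorem `Gallagher.Ici_subset_primeGapLimitSet_of_poisson`, BY NAME). -/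
theorem erdos_of_emptyWindowPoisson (h : (∀ s : ℝ, 0 < s → ∀ g : ℕ → ℕ,
    Filter.Tendsto (fun N : ℕ => (g N : ℝ) / Real.log N) Filter.atTop (nhds s) →
    Filter.Tendsto (fun N : ℕ => (Gallagher.exactCount 0 (g N) N : ℝ) / N) Filter.atTop (nhds (Real.exp (-s))))) : (Set.Ici (0 : ℝ) ⊆ primeGapLimitSet) :=
  Gallagher.Ici_subset_primeGapLimitSet_of_poisson h

/-- Erdős ⟹ the notch (dial `2 ≤ 3`). -/
theorem threePoint_of_erdos (h : (Set.Ici (0 : ℝ) ⊆ primeGapLimitSet)) : ThreePoint :=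
  hasPointProperty_of_Ici_subset h (by norm_num)

/-- The whole printed chain in one line: Poisson(k = 0) ⟹ ThreePoint. -/
theorem threePoint_of_emptyWindowPoisson (h : (∀ s : ℝ, 0 < s → ∀ g : ℕ → ℕ,
    Filter.Tendsto (fun N : ℕ => (g N : ℝ) / Real.log N) Filter.atTop (nhds s) →
    Filter.Tendsto (fun N : ℕ => (Gallagher.exactCount 0 (g N) N : ℝ) / N) Filter.atTop (nhds (Real.exp (-s))))) : ThreePoint :=
  threePoint_of_erdos (erdos_of_emptyWindowPoisson h)

/-! ## §5 The deciding theorem and exactness -/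

/-- **`closes_kernel`** (the born file owns `closes`) — the node decides the conjunct: Q → FU → FL → ThreePoint → GapLift → GHL
(5 binders, every one consumed). -/
theorem closes_kernel (hQ : BoundedSiegelZeroQuality) (hFU : FixedUpper) (hFL : FixedLower)
    (hN : ThreePoint) (hR : GapLift) : _root_.GeneralizedHardyLittlewood :=
  ghl_of_leaves hQ hFU (hR hN).1 hFL (hR hN).2

/-- **Exactness of the node (modulo the sibling leaves Q, FU, FL):** `(UU ∧ UL) ↔ (ThreePoint ∧ GapLift)`. -/
theorem node_iff (hQ : BoundedSiegelZeroQuality) (hFU : FixedUpper) (hFL : FixedLower) :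
    (SiegelSpectrumSplit.UniformUpperGivenFixed ∧ SiegelSpectrumSplit.UniformLowerGivenFixed) ↔ (ThreePoint ∧ GapLift) :=
  ⟨fun h => ⟨threePoint_of_leaves hQ hFU h.1 hFL h.2, gapLift_of_uniform h.1 h.2⟩,
    fun h => h.2 h.1⟩

/-- **Exactness at the conjunct:** GHL ↔ (Q ∧ FU ∧ FL ∧ ThreePoint ∧ GapLift), modulo the record's own
standing hypothesis GHL ⟹ Q (Matomäki–Merikoski 2023, as in the record's `node_iff`). -/
theorem conjunct_iff (hQ_of_ghl : _root_.GeneralizedHardyLittlewood → BoundedSiegelZeroQuality) :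
    _root_.GeneralizedHardyLittlewood ↔
      (BoundedSiegelZeroQuality ∧ FixedUpper ∧ FixedLower ∧ ThreePoint ∧ GapLift) :=
  ⟨fun h => ⟨hQ_of_ghl h, ShiftedPrimeFactor.fixedUpper_of_ghl h, ShiftedPrimeFactor.fixedLower_of_ghl h,
      threePoint_of_ghl h, gapLift_of_ghl h⟩,
    fun h => closes_kernel h.1 h.2.1 h.2.2.1 h.2.2.2.1 h.2.2.2.2⟩

/-- T11 (e) kernel hygiene — the residual's TRIVIAL branch: if the notch fails, `GapLift` holds vacuously;
its content branch is `UU ∧ UL` given `ThreePoint` (so a skeleton's heart stub is stated on that branch only). -/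
theorem gapLift_of_not_threePoint (h : ¬ ThreePoint) : GapLift := fun hN => absurd hN h

/-- T11 (b) contraction rule in the kernel: once `ThreePoint` is a theorem, the residual IS the pair of
uniform leaves (the route contracts onto the record). -/
theorem gapLift_iff_of_threePoint (hN : ThreePoint) :
    GapLift ↔ (SiegelSpectrumSplit.UniformUpperGivenFixed ∧ SiegelSpectrumSplit.UniformLowerGivenFixed) :=
  ⟨fun hR => hR hN, fun h _ => h⟩

/-- The residual alone with the conjunct's consequence: `GapLift` is all that separates `ThreePoint` from
the uniform leaves (zero-credit bookkeeping: when `ThreePoint` lands, the route contracts onto the record). -/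
theorem uniform_of_pieces (hN : ThreePoint) (hR : GapLift) :
    SiegelSpectrumSplit.UniformUpperGivenFixed ∧ SiegelSpectrumSplit.UniformLowerGivenFixed := hR hN

end Summit.Parity.GeneralizedHardyLittlewood.Theses.GapLimitPointSplit
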